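import Summits.Ventures.PercRepro.K5MatroidRankA
import Summits.Ventures.PercRepro.K5MatroidRankB

/-!
# PercRepro — the cycle matroid `M(K₅)` on `Fin 10` and its profile table (p9, gen 15; local draft)

On `K5MatroidDefs` / `K5MatroidRankA/B` (the forests of `K₅`, the augmentation axiom and the union-find rank, all
decided in the kernel): `rkG = rk` on every edge set, the matroid `K5` by `IndepMatroid.ofFinset`, `eRk_coe : K5.eRk ↑X = rk X`,
and the profile table `(rk X, rk Xᶜ)` over the 1024 edge subsets, `(0,4)·1 (1,4)·10 (2,4)·55 (3,4)·230 (4,0)·1 (4,1)·10 (4,2)·55 (4,3)·230 (4,4)·432`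
(the fibre counts on the union-find profile, `sum_profile`, `four_le_rk_add_rk_compl`). Nothing here is about any window of S4.
-/

namespace PercRepro.K5Ladder

open Finset

/-- **Union-find computes the matroid rank** on every edge set (by the number of edges). -/
theorem rkG_eq_rk (X : Finset (Fin 10)) : rkG X = rk X := by
  have h : X.card ≤ 10 := by simpa using Finset.card_le_univ X
  obtain ⟨n, hn⟩ : ∃ n, X.card = n := ⟨_, rfl⟩
  have hn10 : n ≤ 10 := hn ▸ h
  interval_cases n
  · exact rkG_eq_rk_0 X hn
  · exact rkG_eq_rk_1 X hn
  · exact rkG_eq_rk_2 X hn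
  · exact rkG_eq_rk_3 X hn
  · exact rkG_eq_rk_4 X hn
  · exact rkG_eq_rk_5 X hn
  · exact rkG_eq_rk_6 X hn
  · exact rkG_eq_rk_7 X hn
  · exact rkG_eq_rk_8 X hn
  · exact rkG_eq_rk_9 X hn
  · exact rkG_eq_rk_10 X hn

/-- The two profile functions agree. -/
theorem profileG_eq : profileG = profile := by
  funext X
  simp only [profileG, profile, rkG_eq_rk X, rkG_eq_rk Xᶜ]

/-- The profiles of `M(K₅)`. -/
theorem image_profileG : (univ : Finset (Finset (Fin 10))).image profileG = {(0, 4), (1, 4), (2, 4), (3, 4), (4, 0), (4, 1), (4, 2), (4, 3), (4, 4)} := by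
  decide +kernel

/-- The profile `(0, 4)` has multiplicity `1`. -/
theorem card_fibre_04 : #{X ∈ (univ : Finset (Finset (Fin 10))) | profileG X = (0, 4)} = 1 := by decide +kernel
/-- The profile `(1, 4)` has multiplicity `10`. -/
theorem card_fibre_14 : #{X ∈ (univ : Finset (Finset (Fin 10))) | profileG X = (1, 4)} = 10 := by decide +kernel
/-- The profile `(2, 4)` has multiplicity `55`. -/
theorem card_fibre_24 : #{X ∈ (univ : Finset (Finset (Fin 10))) | profileG X = (2, 4)} = 55 := by decide +kernel
/-- The profile `(3, 4)` has multiplicity `230`. -/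
theorem card_fibre_34 : #{X ∈ (univ : Finset (Finset (Fin 10))) | profileG X = (3, 4)} = 230 := by decide +kernel
/-- The profile `(4, 0)` has multiplicity `1`. -/
theorem card_fibre_40 : #{X ∈ (univ : Finset (Finset (Fin 10))) | profileG X = (4, 0)} = 1 := by decide +kernel
/-- The profile `(4, 1)` has multiplicity `10`. -/
theorem card_fibre_41 : #{X ∈ (univ : Finset (Finset (Fin 10))) | profileG X = (4, 1)} = 10 := by decide +kernel
/-- The profile `(4, 2)` has multiplicity `55`. -/
theorem card_fibre_42 : #{X ∈ (univ : Finset (Finset (Fin 10))) | profileG X = (4, 2)} = 55 := by decide +kernel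
/-- The profile `(4, 3)` has multiplicity `230`. -/
theorem card_fibre_43 : #{X ∈ (univ : Finset (Finset (Fin 10))) | profileG X = (4, 3)} = 230 := by decide +kernel
/-- The profile `(4, 4)` has multiplicity `432`. -/
theorem card_fibre_44 : #{X ∈ (univ : Finset (Finset (Fin 10))) | profileG X = (4, 4)} = 432 := by decide +kernel

/-- `4 ≤ rk X + rk Xᶜ` for every edge set (every profile of `M(K₅)` has `k₁ + k₂ ≥ 4`). -/
theorem four_le_rk_add_rk_compl (X : Finset (Fin 10)) : 4 ≤ rk X + rk Xᶜ := by
  have h : profileG X ∈ (univ : Finset (Finset (Fin 10))).image profileG := Finset.mem_image_of_mem _ (mem_univ X)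
  rw [image_profileG, profileG_eq] at h
  simp only [Finset.mem_insert, Finset.mem_singleton, profile, Prod.mk.injEq] at h
  omega

/-- **The profile table of `M(K₅)`**: any sum over the 1024 edge subsets of a function of the profile
`(rk X, rk Xᶜ)` is `F(0,4) + 10·F(1,4) + 55·F(2,4) + 230·F(3,4) + F(4,0) + 10·F(4,1) + 55·F(4,2) + 230·F(4,3) + 432·F(4,4)`. -/
theorem sum_profile (F : ℕ × ℕ → ℕ) :
    ∑ X : Finset (Fin 10), F (profile X) = F (0, 4) + 10 * F (1, 4) + 55 * F (2, 4) + 230 * F (3, 4)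
      + F (4, 0) + 10 * F (4, 1) + 55 * F (4, 2) + 230 * F (4, 3) + 432 * F (4, 4) := by
  rw [← profileG_eq, Finset.sum_comp, image_profileG]
  rw [Finset.sum_insert (by decide), Finset.sum_insert (by decide), Finset.sum_insert (by decide), Finset.sum_insert (by decide), Finset.sum_insert (by decide), Finset.sum_insert (by decide), Finset.sum_insert (by decide), Finset.sum_insert (by decide), Finset.sum_singleton, card_fibre_04, card_fibre_14, card_fibre_24, card_fibre_34, card_fibre_40, card_fibre_41, card_fibre_42, card_fibre_43, card_fibre_44]
  simp only [smul_eq_mul, one_mul]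
  ring

/-! ### The matroid -/

/-- **The cycle matroid `M(K₅)`** on `Fin 10`, from the independence axioms of the forests. -/
def K5 : Matroid (Fin 10) :=
  (IndepMatroid.ofFinset (E := (Set.univ : Set (Fin 10))) indepF indepF_empty
    (fun _ _ hJ hIJ => indepF_subset hJ hIJ) (fun _ _ hI hJ h => indepF_aug _ _ hI hJ h)
    (fun _ _ => Set.subset_univ _)).matroid

/-- The ground set of `K5` is `Fin 10`. -/
theorem K5_ground : K5.E = Set.univ := rfl

/-- `M(K₅)` is a finite matroid. -/
theorem K5_finite : K5.Finite := ⟨Set.finite_univ⟩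

/-- Independence in `K5` is `indepF`. -/
theorem K5_indep_iff (I : Finset (Fin 10)) : K5.Indep ↑I ↔ indepF I := by
  rw [K5, IndepMatroid.matroid_indep_iff, IndepMatroid.ofFinset_indep]

/-- **The rank function of `M(K₅)`** is `rk`. -/
theorem eRk_coe (X : Finset (Fin 10)) : K5.eRk ↑X = (rk X : ℕ∞) := by
  rw [rk_eq]
  apply le_antisymm
  · rw [Matroid.eRk_le_iff]
    intro I hIX hI
    obtain ⟨J, rfl⟩ := (Set.toFinite I).exists_finset_coe
    rw [K5_indep_iff] at hI
    rw [Set.encard_coe_eq_coe_finsetCard]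
    exact_mod_cast Finset.le_sup (f := Finset.card)
      (Finset.mem_filter.2 ⟨Finset.mem_powerset.2 (Finset.coe_subset.1 hIX), hI⟩)
  · rw [Matroid.le_eRk_iff]
    obtain ⟨J, hJ, hJsup⟩ := Finset.exists_mem_eq_sup (X.powerset.filter indepF)
      ⟨∅, Finset.mem_filter.2 ⟨Finset.mem_powerset.2 (Finset.empty_subset X), indepF_empty⟩⟩ Finset.card
    rw [Finset.mem_filter, Finset.mem_powerset] at hJ
    exact ⟨↑J, Finset.coe_subset.2 hJ.1, (K5_indep_iff J).2 hJ.2,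
      by rw [Set.encard_coe_eq_coe_finsetCard, hJsup]⟩

/-- The rank of the complement of an edge set. -/
theorem eRk_compl_coe (X : Finset (Fin 10)) : K5.eRk (K5.E \ ↑X) = (rk Xᶜ : ℕ∞) := by
  rw [K5_ground, ← Set.compl_eq_univ_sdiff, ← Finset.coe_compl, eRk_coe]

end PercRepro.K5Ladder
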